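import Summits.Ventures.PercRepro.ProfileFlatUpsetCorankTwo
import Summits.Ventures.PercRepro.ProfileFlatUpsetLarge
import Summits.Ventures.PercRepro.ProfileFlatUpsetSmallPrincipal

/-!
# PercRepro — (G) AT EVERY PRINCIPAL UP-SET OF A FLAT OF CORANK AT MOST TWO, ON EVERY FINITE MATROID
(p10, gen 19; `proofs/P10-AVFULL.md` §27(i))

Glue of the three gen-19 modules: for a flat `F₀` with `rk M ≤ rk F₀ + 2`, (G) holds at `principalUp M F₀` on every
number `N` of points — `N ≥ 2r − 1` termwise (`sum_sepSets_nonneg_of_two_mul_rk_le`), `N ≤ 2 rk F₀ + 1` by the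
unique-trace double counting (`sum_sepSets_principal_nonneg_of_card_le`; this is every remaining `N` when
`rk F₀ ≥ r − 1`, and `N ≤ 2r − 3` when `rk F₀ = r − 2`), and the one case left, `rk F₀ = r − 2` on `N = 2r − 2`
points, by the key-lemma double counting (`sum_sepSets_principal_corank_two_nonneg`).  THEOREM
`sum_sepSets_principal_nonneg_of_corank_le_two`.  In pointed language: the coloop limit (C1′) for every point placed
freely on a flat of corank `≤ 2`, of which only the corank-two case on `2r − 2` points is outside the proved pointed
regimes of gens 15–17.  Nothing here asserts (G) in general.
-/

open scoped Matroid

namespace PercRepro.Cogirth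

open Finset ThmH Skew

variable {α : Type} [DecidableEq α] {M : Matroid α} [M.Finite]

/-- **(G) AT EVERY PRINCIPAL UP-SET OF A FLAT OF CORANK `≤ 2`**: for a flat `F₀` with `rk M ≤ rk F₀ + 2`,
the signed sum of (G) at `principalUp M F₀` is non-negative, on every finite matroid. -/
theorem sum_sepSets_principal_nonneg_of_corank_le_two {F₀ : Finset α} (hF : IsFlatF M F₀)
    (hr : rk M (gr M) ≤ rk M F₀ + 2) :
    0 ≤ ∑ Z ∈ sepSets M (principalUp M F₀), (2 * (Z.card : ℤ) - (gr M).card - 1) := by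
  by_cases hbig : 2 * rk M (gr M) ≤ (gr M).card + 1
  · exact sum_sepSets_nonneg_of_two_mul_rk_le (upFlats_principalUp F₀) hbig
  · by_cases hsmall : (gr M).card ≤ 2 * rk M F₀ + 1
    · exact sum_sepSets_principal_nonneg_of_card_le hF hsmall
    · -- `N ≥ 2 rk F₀ + 2` and `N ≤ 2r − 2` force `rk F₀ + 2 = r` and `N = 2r − 2`
      have h1 : rk M F₀ + 2 = rk M (gr M) := by omega
      have h2 : (gr M).card + 2 = 2 * rk M (gr M) := by omega
      exact sum_sepSets_principal_corank_two_nonneg hF h1 h2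

end PercRepro.Cogirth
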